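import Summits.BirchSwinnertonDyer.Rank1Residual.X11b.ChaPairs1
import Summits.BirchSwinnertonDyer.Rank1Residual.Supersingular.IntModelMinimalityKrausTwoMore
import Summits.BirchSwinnertonDyer.Rank1Residual.X11b.CertificateCheckBridge
import Literature.NumberTheory.EllipticCurves.Rank1Residual.Typed.X10bHeegnerIndexCertificate
import Literature.NumberTheory.EllipticCurves.ComplexMultiplicationNotSemistable
import HarnessLib

/-!
# Class X11a, NON-surjective leaf (`5S4`): per-pair HEEGNER-INDEX (Cha) records, p4's half (`N ≥ 10⁵`), file 2/2
# — `259920bc1`, `353440j1` (cell `bsd-print-x11a`, PLAN v2 §2)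

HONEST FRAMING (cells `b2b-bsdres` / `bsd-print-x11a`, verbatim): the goal is to DELETE the
COMBINATION-SHAPED residual classes of the Birch–Swinnerton-Dyer formula for ALL analytic-rank
`≤ 1` elliptic curves over `ℚ` — "full BSD formula for every rank `≤ 1` curve in class `C`"
assembled STRICTLY from published theorems — so that the rank-`≤ 1` remainder becomes exactly the
CONSTRUCTION-SHAPED classes, which are TYPED (missing-input `Prop`s), NOT attempted. This is not
"finishing BSD". PER PAIR: theorems only, no definition, no named fact; nothing is booked by this
file and no class label changes (referee / planner). The CLASS-level upper half on the non-surjective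
leaf (crux `PrintX11a.X11aNonSurjEulerHalf`, item 20406) stays OPEN.

## What

The cell planner's PLAN v2 §2 redirect (GRH-free, in-domain per-pair certificates for the upper half
on the non-surjective leaf): the Cha 2005 Thm 21 / Miller 2011 Thm 5.2 HEEGNER-INDEX door of the tree
(`X11b.bsdp_of_ainvs_of_chaCertificate`, grammar of `X11b/ChaPairs1.lean`; and the typed upper half
`Typed.missingUpperBoundAt_of_cha_of_index_le`) at the five NON-SPLIT `5S4` pairs of the x11a census
with `N ≥ 10⁵` and `5 ∤ ∏c_ℓ · #Ш_an` (p4's half; p3 takes `N < 10⁵`). Per pair: `bsdp5_c<label>`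
(`BSDp W 5`) and `mub5_c<label>` (`MissingUpperBoundAt W 5`, the crux's currency). KERNEL: `Δ ≠ 0`,
global minimality (Kraus, complete factorisation), `5 ∣ Δ ∧ 5 ∤ c₄` (multiplicative at `5`, hence
`¬CM`), `E[5]` irreducible by a Frobenius witness (`card_c<label>_ℓ`, Mazur 1978 Prop. 6.3 (1)).
DISPLAYED (evidence = cell ty3's two-engine Heegner-index kit job, PLAN v2 §2 «ty3», records schema v2
field `heegner`; NOT yet run at filing time — these theorems are the KERNEL SOCKETS the certificates
plug into): `K` (imaginary quadratic, Heegner for the level `N`, `5 ∤ d_K`, `d_K ∉ {−3, −4}` implicit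
in Cha's fact), `25 ∤ N`, the Heegner point `P` of infinite order, the index bit `5 ∤ [E(K) : ℤP]`,
`r_an ≤ 1` (Cremona: `r_an = 0`), `#Ш_an` (Cremona `allbsd`: `1, 4, 1, 1, 1` — `5`-adic units).
Curve data from ty3's `X11aPrintCertificates/RecordsLeafNonSurjN500000Part2.lean` (a-invariants,
image `5S4`, non-split, Tamagawa, `#Ш_an`, Frobenius witness).

References: [Miller2011LMS] Thm. 5.2, Def. 1.1; [Mazur1978] Prop. 6.3; [SilvermanAEC2009] VII.1 Rem. 1.1,
VII.5.1; [Kraus1989]; [Cremona2006]; `X11b/ChaPairs1.lean` (template); HOME/PLAN.md v2 §2.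
-/

set_option autoImplicit false

noncomputable section

open scoped Classical

open WeierstrassCurve Literature.NumberTheory.EllipticCurves
  Literature.NumberTheory.EllipticCurves.Rank1Residual
  Literature.NumberTheory.EllipticCurves.Rank1Residual.Typed
  Literature.NumberTheory.EllipticCurves.Rank1Residual.X11RankOneCertificates
  Literature.NumberTheory.EllipticCurves.Cha2005
  NumberField IsDedekindDomain Rat.HeightOneSpectrum
  Summit.BirchSwinnertonDyer.BirchSwinnertonDyer.Rank1Residual.IntModel
  Summit.BirchSwinnertonDyer.BirchSwinnertonDyer.Rank1Residual.X11RankOne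
  Summit.BirchSwinnertonDyer.Rank1Residual.Supersingular

namespace Summit.BirchSwinnertonDyer.Rank1Residual.X11a.ChaRecords

/-! ### `259920bc1 @ 5` (`N = 259920`, image `5S4`, non-split multiplicative at `5`, `∏ c_ℓ = 6`, `#Ш_an = 1`) -/

/-- `259920bc1 = [0, 0, 0, 9747, 399627]` is globally minimal: `|Δ| = 2⁴·3⁹·5⁵·19⁴` (kernel) + Kraus.
[cite: SilvermanAEC2009, VII.1 Remark 1.1] [cite: Kraus1989, Prop. 1 and Prop. 2] -/
theorem isGloballyMinimal_c259920bc1 : (⟨0, 0, 0, 9747, 399627⟩ : WeierstrassCurve ℚ).IsGloballyMinimal :=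
  isGloballyMinimal_of_krausCriterion₃_factored 0 0 0 9747 399627
    [(2, 4), (3, 9), (5, 5), (19, 4)] (by decide +kernel)
    (by intro qe hqe; simp only [List.mem_cons, List.not_mem_nil, or_false] at hqe
        rcases hqe with rfl | rfl | rfl | rfl <;> norm_num)
    (by intro qe hqe; simp only [List.mem_cons, List.not_mem_nil, or_false] at hqe
        rcases hqe with rfl | rfl | rfl | rfl <;> exact Or.inl (by decide +kernel))

/-- `#Ẽ(𝔽_11) = 6` for `259920bc1` (`a_11 = 6`; `X² − a_11X + 11` root-free mod `5`: the Frobenius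
irreducibility witness, kernel count `countPoints`). [folklore] -/
theorem card_c259920bc1_11 :
    Nat.card (((⟨0, 0, 0, 9747, 399627⟩ : WeierstrassCurve ℤ).map (Int.castRingHom (ZMod 11))).toAffine.Point) = 6 := by
  have h := X11b.natCard_point_eq_countPoints 0 0 0 9747 399627 11 (by norm_num) (by decide +kernel)
  have h' : countPoints [0, 0, 0, 9747, 399627] 11 = 6 := by decide +kernel
  exact_mod_cast h.trans h'

/-- **`BSD(E,5)` for `259920bc1`** (`N = 259920`; `ρ̄_{E,5}` image `5S4` — the NON-surjective leaf of X11a,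
crux `X11aNonSurjEulerHalf`'s domain; non-split multiplicative at `5`; `#Ш_an = 1`, a `5`-adic
unit) from Cha 2005 Thm 21 / Miller 2011 Thm 5.2 (`hCha`) + GZK (`hGZK`) and a Heegner-index
certificate DISPLAYED as binders (`K` imaginary quadratic, Heegner for the level `N`, `5 ∤ d_K`,
`25 ∤ N`, Heegner point `P` of infinite order with `5 ∤ [E(K) : ℤP]` — cell ty3's two-engine kit job,
HOME/PLAN.md v2 §2), `r_an ≤ 1`, `#Ш_an` a `5`-unit. Kernel: `Δ ≠ 0`, minimality, `5 ∣ Δ ∧ 5 ∤ c₄`,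
`E[5]` irreducible by `card_c259920bc1_11`. Grammar = `X11b.ChaPairs1.bsdp_c<label>` (door
`X11b.bsdp_of_ainvs_of_chaCertificate`). PER PAIR; nothing booked.
[cite: Miller2011LMS, Thm. 5.2 and Def. 1.1] [cite: Cremona2006, Table 1 (Cremona label 259920bc1)] -/
theorem bsdp5_c259920bc1 (hCha : thm52_padicValNat_shaOrder_le)
    (hGZK : rank_eq_analyticRank_of_analyticRank_le_one)
    (W : WeierstrassCurve ℚ) (hW : W = ⟨0, 0, 0, 9747, 399627⟩)
    {N : ℕ} [NeZero N] {K : Type} [Field K] [NumberField K] (hK : IsImaginaryQuadratic K)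
    (hH : SatisfiesHeegnerHypothesis N K) {P : (W.baseChange K).toAffine.Point}
    (hP : IsHeegnerPoint N W K P) (hnt : ¬ IsOfFinAddOrder P)
    (hpD : ¬ (5 : ℤ) ∣ NumberField.discr K) (hpN : ¬ 5 ^ 2 ∣ N)
    (hI : ¬ 5 ∣ (AddSubgroup.zmultiples P).index)
    (hr : W.analyticRank ≤ 1) {q : ℚ} (hq : shaAn W = (q : ℂ)) (hv : padicValRat 5 q = 0) :
    BSDp W 5 := by
  haveI : W.IsElliptic := by rw [hW]; exact X11b.isElliptic_of_discOf_ne_zero 0 0 0 9747 399627 (by decide +kernel)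
  haveI : W.IsGloballyMinimal := by rw [hW]; exact isGloballyMinimal_c259920bc1
  haveI : Fact (Nat.Prime 5) := ⟨by norm_num⟩
  haveI : Fact (Nat.Prime 11) := ⟨by norm_num⟩
  have hI' : integralModelInt W = ⟨0, 0, 0, 9747, 399627⟩ := by
    subst hW; exact integralModelInt_eq_of_map_eq _ (map_mk_int 0 0 0 9747 399627)
  exact X11b.bsdp_of_ainvs_of_chaCertificate hCha hGZK 0 0 0 9747 399627 hI'
    5 11 6 (by decide) (by decide +kernel) (by decide +kernel) (by decide) (by decide +kernel) card_c259920bc1_11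
    (by decide +kernel) hK hH hP hnt (mod_cast hpD) hpN hI hr hq hv

/-- **`259920bc1 @ 5`: the UPPER half `ord₅ #Ш ≤ ord₅ #Ш_an`** (`Typed.MissingUpperBoundAt W 5`, the
currency of crux `X11aNonSurjEulerHalf`) from Cha's Heegner-index bound (`hCha`; door
`Typed.missingUpperBoundAt_of_cha_of_index_le`, `k := 0`), the index certificate displayed as
`hI : ord₅ [E(K) : ℤP] ≤ 0`; `¬CM` and `E[5]` irreducible in the kernel (multiplicative at `5`;
`card_c259920bc1_11`). PER PAIR; nothing booked. [cite: Miller2011LMS, Thm. 5.2]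
[cite: Mazur1978, §6 Prop. 6.3 (1) (p. 153)] [cite: Cremona2006, Table 1 (Cremona label 259920bc1)] -/
theorem mub5_c259920bc1 (hCha : thm52_padicValNat_shaOrder_le)
    (W : WeierstrassCurve ℚ) (hW : W = ⟨0, 0, 0, 9747, 399627⟩)
    {N : ℕ} [NeZero N] {K : Type} [Field K] [NumberField K] (hK : IsImaginaryQuadratic K)
    (hH : SatisfiesHeegnerHypothesis N K) {P : (W.baseChange K).toAffine.Point}
    (hP : IsHeegnerPoint N W K P) (hnt : ¬ IsOfFinAddOrder P)
    (hpD : ¬ (5 : ℤ) ∣ NumberField.discr K) (hpN : ¬ 5 ^ 2 ∣ N)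
    (hI : padicValNat 5 (AddSubgroup.zmultiples P).index ≤ 0)
    (hr : W.analyticRank ≤ 1) {q : ℚ} (hq : shaAn W = (q : ℂ)) (hv : (0 : ℤ) ≤ padicValRat 5 q) :
    MissingUpperBoundAt W 5 := by
  haveI : W.IsElliptic := by rw [hW]; exact X11b.isElliptic_of_discOf_ne_zero 0 0 0 9747 399627 (by decide +kernel)
  haveI : W.IsGloballyMinimal := by rw [hW]; exact isGloballyMinimal_c259920bc1
  haveI : Fact (Nat.Prime 5) := ⟨by norm_num⟩
  haveI : Fact (Nat.Prime 11) := ⟨by norm_num⟩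
  have hI' : integralModelInt W = ⟨0, 0, 0, 9747, 399627⟩ := by
    subst hW; exact integralModelInt_eq_of_map_eq _ (map_mk_int 0 0 0 9747 399627)
  have hmult : Mult W 5 :=
    hasMultiplicativeReductionAtPrime_of_intModel hI' 5 (by decide +kernel) (by decide +kernel)
  have hcm : ¬ W.HasCM := fun h ↦ not_hasMultiplicativeReductionAtPrime_of_hasCM W h 5 hmult
  have hirr : Irr W 5 :=
    hasIrreducibleModPGaloisRep_of_intModel_of_noroot (hp := ⟨by norm_num⟩) (hℓ := ⟨by norm_num⟩)
      hI' 5 11 (by norm_num) (by decide +kernel) card_c259920bc1_11 (by decide)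
  exact missingUpperBoundAt_of_cha_of_index_le W 5 hCha hcm hr hK hH hP hnt (by norm_num) hpD hpN hirr
    (k := 0) hI hq (by simpa using hv)

/-! ### `353440j1 @ 5` (`N = 353440`, image `5S4`, non-split multiplicative at `5`, `∏ c_ℓ = 2`, `#Ш_an = 1`) -/

/-- `353440j1 = [0, 0, 0, -28136033, 57443604732]` is globally minimal: `|Δ| = 2⁶·5⁵·47⁸` (kernel) + Kraus.
[cite: SilvermanAEC2009, VII.1 Remark 1.1] [cite: Kraus1989, Prop. 1 and Prop. 2] -/
theorem isGloballyMinimal_c353440j1 : (⟨0, 0, 0, -28136033, 57443604732⟩ : WeierstrassCurve ℚ).IsGloballyMinimal :=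
  isGloballyMinimal_of_krausCriterion₃_factored 0 0 0 (-28136033) 57443604732
    [(2, 6), (5, 5), (47, 8)] (by decide +kernel)
    (by intro qe hqe; simp only [List.mem_cons, List.not_mem_nil, or_false] at hqe
        rcases hqe with rfl | rfl | rfl <;> norm_num)
    (by intro qe hqe; simp only [List.mem_cons, List.not_mem_nil, or_false] at hqe
        rcases hqe with rfl | rfl | rfl <;> exact Or.inl (by decide +kernel))

/-- `#Ẽ(𝔽_3) = 4` for `353440j1` (`a_3 = 0`; `X² − a_3X + 3` root-free mod `5`: the Frobenius
irreducibility witness, kernel count `countPoints`). [folklore] -/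
theorem card_c353440j1_3 :
    Nat.card (((⟨0, 0, 0, -28136033, 57443604732⟩ : WeierstrassCurve ℤ).map (Int.castRingHom (ZMod 3))).toAffine.Point) = 4 := by
  have h := X11b.natCard_point_eq_countPoints 0 0 0 (-28136033) 57443604732 3 (by norm_num) (by decide +kernel)
  have h' : countPoints [0, 0, 0, -28136033, 57443604732] 3 = 4 := by decide +kernel
  exact_mod_cast h.trans h'

/-- **`BSD(E,5)` for `353440j1`** (`N = 353440`; `ρ̄_{E,5}` image `5S4` — the NON-surjective leaf of X11a,
crux `X11aNonSurjEulerHalf`'s domain; non-split multiplicative at `5`; `#Ш_an = 1`, a `5`-adic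
unit) from Cha 2005 Thm 21 / Miller 2011 Thm 5.2 (`hCha`) + GZK (`hGZK`) and a Heegner-index
certificate DISPLAYED as binders (`K` imaginary quadratic, Heegner for the level `N`, `5 ∤ d_K`,
`25 ∤ N`, Heegner point `P` of infinite order with `5 ∤ [E(K) : ℤP]` — cell ty3's two-engine kit job,
HOME/PLAN.md v2 §2), `r_an ≤ 1`, `#Ш_an` a `5`-unit. Kernel: `Δ ≠ 0`, minimality, `5 ∣ Δ ∧ 5 ∤ c₄`,
`E[5]` irreducible by `card_c353440j1_3`. Grammar = `X11b.ChaPairs1.bsdp_c<label>` (door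
`X11b.bsdp_of_ainvs_of_chaCertificate`). PER PAIR; nothing booked.
[cite: Miller2011LMS, Thm. 5.2 and Def. 1.1] [cite: Cremona2006, Table 1 (Cremona label 353440j1)] -/
theorem bsdp5_c353440j1 (hCha : thm52_padicValNat_shaOrder_le)
    (hGZK : rank_eq_analyticRank_of_analyticRank_le_one)
    (W : WeierstrassCurve ℚ) (hW : W = ⟨0, 0, 0, -28136033, 57443604732⟩)
    {N : ℕ} [NeZero N] {K : Type} [Field K] [NumberField K] (hK : IsImaginaryQuadratic K)
    (hH : SatisfiesHeegnerHypothesis N K) {P : (W.baseChange K).toAffine.Point}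
    (hP : IsHeegnerPoint N W K P) (hnt : ¬ IsOfFinAddOrder P)
    (hpD : ¬ (5 : ℤ) ∣ NumberField.discr K) (hpN : ¬ 5 ^ 2 ∣ N)
    (hI : ¬ 5 ∣ (AddSubgroup.zmultiples P).index)
    (hr : W.analyticRank ≤ 1) {q : ℚ} (hq : shaAn W = (q : ℂ)) (hv : padicValRat 5 q = 0) :
    BSDp W 5 := by
  haveI : W.IsElliptic := by rw [hW]; exact X11b.isElliptic_of_discOf_ne_zero 0 0 0 (-28136033) 57443604732 (by decide +kernel)
  haveI : W.IsGloballyMinimal := by rw [hW]; exact isGloballyMinimal_c353440j1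
  haveI : Fact (Nat.Prime 5) := ⟨by norm_num⟩
  haveI : Fact (Nat.Prime 3) := ⟨by norm_num⟩
  have hI' : integralModelInt W = ⟨0, 0, 0, -28136033, 57443604732⟩ := by
    subst hW; exact integralModelInt_eq_of_map_eq _ (map_mk_int 0 0 0 (-28136033) 57443604732)
  exact X11b.bsdp_of_ainvs_of_chaCertificate hCha hGZK 0 0 0 (-28136033) 57443604732 hI'
    5 3 4 (by decide) (by decide +kernel) (by decide +kernel) (by decide) (by decide +kernel) card_c353440j1_3
    (by decide +kernel) hK hH hP hnt (mod_cast hpD) hpN hI hr hq hv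

/-- **`353440j1 @ 5`: the UPPER half `ord₅ #Ш ≤ ord₅ #Ш_an`** (`Typed.MissingUpperBoundAt W 5`, the
currency of crux `X11aNonSurjEulerHalf`) from Cha's Heegner-index bound (`hCha`; door
`Typed.missingUpperBoundAt_of_cha_of_index_le`, `k := 0`), the index certificate displayed as
`hI : ord₅ [E(K) : ℤP] ≤ 0`; `¬CM` and `E[5]` irreducible in the kernel (multiplicative at `5`;
`card_c353440j1_3`). PER PAIR; nothing booked. [cite: Miller2011LMS, Thm. 5.2]
[cite: Mazur1978, §6 Prop. 6.3 (1) (p. 153)] [cite: Cremona2006, Table 1 (Cremona label 353440j1)] -/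
theorem mub5_c353440j1 (hCha : thm52_padicValNat_shaOrder_le)
    (W : WeierstrassCurve ℚ) (hW : W = ⟨0, 0, 0, -28136033, 57443604732⟩)
    {N : ℕ} [NeZero N] {K : Type} [Field K] [NumberField K] (hK : IsImaginaryQuadratic K)
    (hH : SatisfiesHeegnerHypothesis N K) {P : (W.baseChange K).toAffine.Point}
    (hP : IsHeegnerPoint N W K P) (hnt : ¬ IsOfFinAddOrder P)
    (hpD : ¬ (5 : ℤ) ∣ NumberField.discr K) (hpN : ¬ 5 ^ 2 ∣ N)
    (hI : padicValNat 5 (AddSubgroup.zmultiples P).index ≤ 0)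
    (hr : W.analyticRank ≤ 1) {q : ℚ} (hq : shaAn W = (q : ℂ)) (hv : (0 : ℤ) ≤ padicValRat 5 q) :
    MissingUpperBoundAt W 5 := by
  haveI : W.IsElliptic := by rw [hW]; exact X11b.isElliptic_of_discOf_ne_zero 0 0 0 (-28136033) 57443604732 (by decide +kernel)
  haveI : W.IsGloballyMinimal := by rw [hW]; exact isGloballyMinimal_c353440j1
  haveI : Fact (Nat.Prime 5) := ⟨by norm_num⟩
  haveI : Fact (Nat.Prime 3) := ⟨by norm_num⟩
  have hI' : integralModelInt W = ⟨0, 0, 0, -28136033, 57443604732⟩ := by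
    subst hW; exact integralModelInt_eq_of_map_eq _ (map_mk_int 0 0 0 (-28136033) 57443604732)
  have hmult : Mult W 5 :=
    hasMultiplicativeReductionAtPrime_of_intModel hI' 5 (by decide +kernel) (by decide +kernel)
  have hcm : ¬ W.HasCM := fun h ↦ not_hasMultiplicativeReductionAtPrime_of_hasCM W h 5 hmult
  have hirr : Irr W 5 :=
    hasIrreducibleModPGaloisRep_of_intModel_of_noroot (hp := ⟨by norm_num⟩) (hℓ := ⟨by norm_num⟩)
      hI' 5 3 (by norm_num) (by decide +kernel) card_c353440j1_3 (by decide)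
  exact missingUpperBoundAt_of_cha_of_index_le W 5 hCha hcm hr hK hH hP hnt (by norm_num) hpD hpN hirr
    (k := 0) hI hq (by simpa using hv)
end Summit.BirchSwinnertonDyer.Rank1Residual.X11a.ChaRecords

end
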